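import Summits.AtomisticToContinuum.Crystallization.Theses.HullExactificationCascade
import Summits.AtomisticToContinuum.Crystallization.Theses.DisclinationRation
import Summits.AtomisticToContinuum.Crystallization.Theorems.ShellsToBarlowChart.Negative.Calibration
import Literature.Geometry.DiscreteGeometry.LayerShellPatterns
import Literature.MathematicalPhysics.StatisticalMechanics.BarlowRings
import Literature.MathematicalPhysics.StatisticalMechanics.BarlowCoordination

/-!
# Disproof of `RobustBarlowTemplate` (crux `stmt-AtomisticToContinuum-12088`) — findings

Work file of the standing crux disprover `cdisprove-stmt-AtomisticToContinuum-12088` (refuter seat),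
sub-problem `Crystallization`, decl SHARED verbatim by the routes `HullExactificationCascade` (C, rank 4)
and `DisclinationRation` (C, rank 4): `robustBarlowTemplate_shared` below is `Iff.rfl`.
Everything outside the section `NearMisses` is sorry-free; prose lives in docstrings.

## Verdict after cycle 1: NO KILL — the crux is very probably TRUE as stated.

The statement (read back symbol by symbol; `W.lean` rc 0): for every `δ > 0` and every nonempty
`δ`-separated `S ⊆ ℝ³` in which EVERY point `y` is `1/20`-good — with `d = d(y) := sInf (dist · y '' (S∖{y}))`
(attained, `≥ δ`) and `T = T(y) := {z ∈ S ∖ {y} : dist z y < 13/10 · d}`, there are a linear isometry `A`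
and a bijection `e : T ≃ fccKissingPattern` or `T ≃ hcpKissingPattern` (unit cuboctahedron /
anticuboctahedron, 12 points each) with `dist (d⁻¹ • (t - y)) (A (e t)) ≤ 1/20` — there are a `±1`
word `s` (`IsHaggSeq`, ANY word) and `Φ` with `Set.BijOn Φ (barlowStacking 1 √(2/3) s) S` that is
`1/20`-close to a similarity `q ↦ Φ p + l_p • A_p (q - p)` (`l_p > 0`, `A_p` a linear isometry, BOTH
depending on `p`) on every unit cluster `{q : dist q p ≤ 1}` (= `p` and its twelve contacts, exactly).
No junk: `d > 0` (two points at least, since a singleton has `T = ∅ ≄ pattern`), `T` finite of card 12,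
the cluster condition at `q = p` is `dist (Φ p) (Φ p) ≤ l/20`.

## Index

* § Named pieces: `nnd`, `shell`, `Good`, `Sep`, `idealStacking`, `LocSim`, `Templated` (same names as
  the lead's `Lines/birth.lean`); `robustBarlowTemplate_iff` / `robustBarlowTemplate_iff'` (`Iff.rfl`
  against both route decls), `robustBarlowTemplate_shared`.
* (a) LOAD-BEARING hypotheses (sorry-free; landed copies proposed under
  `Theorems/RobustBarlowTemplate/Negative/LoadBearing.lean`):
  - `robustBarlowTemplate_false_without_nonempty` — drop `S.Nonempty`: `S = ∅` (the template is
    nonempty, `BijOn` onto `∅` impossible).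
  - `robustBarlowTemplate_false_without_good` — drop the pointwise goodness: `S = {0}` (two distinct
    template points cannot be injected into a singleton).
  - `RobustBarlowTemplateWithoutSep` (statement only) — drop `δ`-separation: NO counterexample found and
    none is expected (§ "Why it resists", item 5): goodness alone forces `d(z)/d(y) ∈ [1/1.05, 1.05]`
    along shells, so the scale can only decay geometrically along paths; an accumulation set `K` would make
    the flat cell complex of `S` a quasi-similar cover of `ℝ³ ∖ K`, impossible for `K` a point
    (`S² × ℝ` carries no complete flat metric) and implausible for any `K` (3-parabolicity of `ℝ³`).
    Information for provers: `δ` enters the intended proof only as the floor making the developed map a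
    covering (co-Lipschitz); it is "possibly unnecessary" but harmless.
  - `RobustBarlowTemplateCountOnly` (§ NearMisses, paper proof, `sorry`) — weaken goodness to
    "`T(y)` has exactly twelve points": FALSE, witness the stretched hcp stacking
    `barlowStacking 1 (23/20) alternatingHagg` (shells `6 × 1.0 ∪ 6 × 1.2868`, next distance `1.6297`;
    twelve points within `1.3 d`, pattern deviation `0.334 ≫ 1/20`); the template fails because a locally
    `1/20`-similar bijection from an ideal stacking extends to a quasi-similar homeomorphism of `ℝ³`
    whose vertex stars are clean, forcing `l_p ≤ d/0.7 = 1.43`, while twelve images in the annulus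
    `[0.95 l, 1.05 l]` need `l ≥ 1.65` there.  Moral: the METRIC pattern match (not twelve-ness) is what
    any proof must use — the `FlexibleKissingArrangements` / negatives-4146 lesson in template form; local
    precedent in the negatives index: stmt-15929 (`ShellCensus_refuted`, the torn icosahedron — a gapped
    twelve-shell that is neither fcc- nor hcp- nor decahedral-like).
* (a′) CALIBRATION (sorry-free): `nnd_idealStacking`, `shell_idealStacking_eq`, `good_idealStacking`,
  `templated_idealStacking`, `hypothesis_idealStacking` — every ideal stacking at every scale `c > 0`, every
  word, is nonempty, `c`-separated, everywhere `0`-good and templated: hypothesis class inhabited as typed.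
* (b) NATURAL STRENGTHENINGS, all false, all compatible with the crux as stated (numerics in docstrings,
  `numerics/*.py` of the seat folder; not formalised — bookkeeping without information):
  - ONE similarity for all `p` (uniform `l`, `A`): false — `S = f(FCC)`, `f(x) = |x|^α x`, `α = 1/100`:
    every shell `1/20`-good (worst deviation `0.0139`, at the first shell; deviation `→ 0` at infinity),
    scale `d(y) ~ |y|^α` UNBOUNDED, holes of every size: `S` is NOT relatively dense and no uniform `l`
    exists.  So provers must not assume bounded scale or relative density (the routes feed relatively
    dense hull elements, but the crux does not say so) — the lead's PICKED.md already works scale-free.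
  - a GLOBAL orientation (uniform `A`): false — log-spiral `g(x) = R_{e₃}(β log(1+|x|)) x`, `β = 1/25`:
    `‖Dg − rotation‖ ≤ β`, shells `1/20`-good (worst `0.046` at `β = 0.05`), frame angle `β log r → ∞`.
  - tolerance trade: hypothesis `η`-good ⇒ conclusion `η`-similar is the crux at `η = 1/20`; the local
    combinatorial rigidity below survives verbatim for `η < 0.0646` ((1+η)² < √2 − 2η needs η < 0.125;
    the √2/√3 transfer `√2 + 2η < (√3 − 2η)/(1+η)` needs `η < 0.0646`); beyond that the first genuinely
    new configurations are NOT known to me below `η ≈ 0.19` (half the bottleneck distance `0.378`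
    between the two unit patterns, `numerics/bottleneck.py`), where a shell may be matched to both.
* (c) `-- Line registered` (the lead's `Lines/birth.lean`, three stubs): NO STUB IS FALSE; audit with
  margins in § Line; joint sufficiency is the lead's kernel-checked `composition`.  State of play read
  from the tree at 09:15Z: `stub_reciprocity` LANDED (p149678, `…StubReciprocity.lean`), `stub_exhaust`
  LANDED (p149628, `…StubExhaust.lean`, with the `60°` covering lemmas `exhaust_cover_fcc/hcp`),
  `develop_charts` (first piece of the reshaped `stub_develop`: local charts with exact links) LANDED;
  open: the rest of `stub_develop` = transport of charts + GLOBAL INJECTIVITY at unbounded scale.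
* (d) `-- Targets`: payload `targets = []`, `stuck_stubs = []` (cycle 1).

## Why it resists (the proof the numbers point to; margins)

Write `y ~ z` iff `z ∈ T(y)`.  From goodness alone:
1. GAP: every `t ∈ T(y)` has `d ≤ dist t y ≤ 1.05 d` (unit pattern point moved by `≤ 1/20`), and
   `S ∩ B(y, 1.3 d) = {y} ∪ T(y)`: the annulus `(1.05 d, 1.3 d)` is EMPTY.  Pattern distances are
   `{1} ∪ [√2, 2]` (fcc `1,√2,√3,2`; hcp `1,√2,√(8/3),√3,√(11/3),2`), so two shell points are either
   "pattern-adjacent", at mutual distance in `[0.9 d, 1.1 d]`, or at distance `≥ (√2 − 0.1) d = 1.3142 d`.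
2. RECIPROCITY (`stub_reciprocity`, TRUE): if `z ∈ T(y)` but `y ∉ T(z)` then `d(z) < dist(y,z)/1.3 ≤ 0.808 d(y)`;
   the shell point `w` of `z` within `45°` (+`3°`) of the direction `z → y` (covering radius of BOTH unit
   patterns is exactly `45°`, `cos = 1/√2`, attained at square-face centres — `numerics/patterns.py`)
   satisfies `dist(y,w) ≤ dist(y,z) · max_{x ≤ 0.77} (√(1 − √2 x + x²) + x/20) ≤ 1.05 d(y) < 1.3 d(y)`, so
   `w ∈ T(y)`, yet `dist(z,w) ≤ 1.05 d(z) ≤ 0.848 d(y) < 0.9 d(y)` — contradiction.  Hence `~` is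
   symmetric and `d(z)/d(y) ∈ [1/1.05, 1.05]` (sharper than the stub's `[9/10, 10/9]`).
3. EXACT LOCAL COMBINATORICS: for `y ~ z` the common neighbours are EXACTLY the four pattern-adjacent
   ones (`1.05 · 1.05 = 1.1025 < 1.3142`; `1.1 · 1.05 = 1.155 < 1.3`), adjacency inside `T(y)` is
   pattern adjacency (`1.1025 < 1.3142`), squares vs. opposite pairs transfer across a bond
   (`√2 + 0.1 = 1.514 < (√3 − 0.1)/1.05 = 1.554`, margin 0.04 d; for hcp-type vertex figures `3.3.4.4`
   the transfer is combinatorial), and the two link graphs are non-isomorphic 4-regular graphs with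
   `|Aut| = 48 = |O_h|` and `12 = |D_{3h}|` (every graph automorphism is geometric).  So the flag/cell
   complex of `(S, ~)` is a tetrahedron–octahedron complex with every vertex link a cuboctahedron or an
   anticuboctahedron and every edge link `3.4.3.4` or `3.3.4.4` (dihedral sums `2·70.53° + 2·109.47° = 360°`).
4. GLOBAL: give each cell its regular unit shape: a flat 3-manifold `M` without singularities; the
   vertex map extends to a PL local homeomorphism `G : M → ℝ³`, locally quasi-similar with scale `d ≥ δ`,
   hence (complete + local isometry for the pulled-back cell metric) a covering of `ℝ³`, hence a
   homeomorphism; so `M` is simply connected, complete, flat: `M ≅ ℝ³` isometrically (Killing–Hopf), the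
   cells become an exact unit tetrahedron–octahedron tiling all of whose vertex figures are (anti)cubocta-
   hedra, i.e. a twelve-touching unit packing, i.e. (PROVED in tree: `HalesDSP_layerPackings_holds`) an
   ideal Barlow stacking up to isometry; `Φ := G ∘ (that isometry)` is the template, `l_p := d(Φ p)`,
   `A_p := A_{Φ p} ∘ (pattern automorphism)`.  The planner's recorded risk ("slow rotation drift at 1/20")
   does not bite: drift is real ((b) above) but the conclusion lets `A_p, l_p` depend on `p`; Zorich-type
   rigidity (a locally homeomorphic quasiregular map of `ℝ³` is injective, n ≥ 3) is exactly why the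
   planar log-spiral COVERING `z ↦ z^k`-type counterexamples of the 2-D analogue do not lift to `ℝ³`.
5. What would kill it: an everywhere-good `S` whose cell complex is a quasi-similar image of a flat
   manifold `ℝ³/Γ`, `Γ ≠ 1` (twin planes of two families, a disclination-free "wrap") — excluded by 4;
   or a shell `1/20`-close to a pattern with the WRONG link graph — excluded by 1 and 3 (margins ≥ 0.04 d).

Disproof used by others: none yet (first cycle).  Sibling precedent: `Cruxes/ShellsToBarlowChart/Disproof.lean`
(crux 9227, tolerance 1/100, bounded scale — same verdict, same drift examples).
-/

noncomputable section

namespace Summit.AtomisticToContinuum.Crystallization.Cruxes.RobustBarlowTemplate.Disproof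

open Literature.MathematicalPhysics.StatisticalMechanics Literature.Geometry.DiscreteGeometry
open Summit.AtomisticToContinuum.Crystallization.Theorems.ShellsToBarlowChartNegative
  (smul_barlowPos smul_mem_barlowStacking_iff ideal_sq shellSet_eq_image_kissingShell)

/-- Euclidean `3`-space. -/
local notation "E3" => EuclideanSpace ℝ (Fin 3)

/-! ## Named pieces of the crux (definitionally the crux text) -/

/-- Nearest-neighbour distance `d(y)` (the crux's `let d`). -/
def nnd (S : Set E3) (y : E3) : ℝ := sInf ((fun z => dist z y) '' (S \ {y}))

/-- First shell `T(y)` (the crux's `let T`): the other points of `S` within `13/10 · d(y)`. -/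
def shell (S : Set E3) (y : E3) : Set E3 :=
  {z : E3 | z ∈ S ∧ z ≠ y ∧ dist z y < 13 / 10 * nnd S y}

/-- `y` is `1/20`-good in `S` (verbatim the crux's pointwise hypothesis). -/
def Good (S : Set E3) (y : E3) : Prop :=
  ∃ A : E3 →ₗᵢ[ℝ] E3,
    (∃ e : ↥(shell S y) ≃ ↥fccKissingPattern, ∀ t : ↥(shell S y),
        dist ((nnd S y)⁻¹ • ((t : E3) - y)) (A ((e t : ↥fccKissingPattern) : E3)) ≤ 1 / 20) ∨
    (∃ e : ↥(shell S y) ≃ ↥hcpKissingPattern, ∀ t : ↥(shell S y),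
        dist ((nnd S y)⁻¹ • ((t : E3) - y)) (A ((e t : ↥hcpKissingPattern) : E3)) ≤ 1 / 20)

/-- `δ`-separation (verbatim). -/
def Sep (δ : ℝ) (S : Set E3) : Prop := ∀ y ∈ S, ∀ z ∈ S, y ≠ z → δ ≤ dist y z

/-- The ideal stacking of the conclusion. -/
def idealStacking (s : ℤ → ℤ) : Set E3 := barlowStacking 1 (Real.sqrt (2 / 3)) s

/-- `Φ` is `1/20`-close to a (point-dependent) similarity on every unit cluster (verbatim). -/
def LocSim (s : ℤ → ℤ) (Φ : E3 → E3) : Prop :=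
  ∀ p ∈ idealStacking s, ∃ A : E3 →ₗᵢ[ℝ] E3, ∃ l : ℝ, 0 < l ∧
    ∀ q ∈ idealStacking s, dist q p ≤ 1 → dist (Φ q) (Φ p + l • A (q - p)) ≤ 1 / 20 * l

/-- The crux's conclusion for `S`: `S` is templated on an ideal Barlow stacking. -/
def Templated (S : Set E3) : Prop :=
  ∃ s : ℤ → ℤ, IsHaggSeq s ∧ ∃ Φ : E3 → E3, Set.BijOn Φ (idealStacking s) S ∧ LocSim s Φ

/-- The crux, route `HullExactificationCascade`, in the named pieces (definitional). -/
theorem robustBarlowTemplate_iff :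
    Summit.AtomisticToContinuum.Crystallization.Theses.HullExactificationCascade.RobustBarlowTemplate ↔
      ∀ δ : ℝ, 0 < δ → ∀ S : Set E3, S.Nonempty → Sep δ S → (∀ y ∈ S, Good S y) → Templated S :=
  Iff.rfl

/-- The crux, route `DisclinationRation`, in the named pieces (definitional). -/
theorem robustBarlowTemplate_iff' :
    Summit.AtomisticToContinuum.Crystallization.Theses.DisclinationRation.RobustBarlowTemplate ↔
      ∀ δ : ℝ, 0 < δ → ∀ S : Set E3, S.Nonempty → Sep δ S → (∀ y ∈ S, Good S y) → Templated S :=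
  Iff.rfl

/-- The two routes share the decl verbatim. -/
theorem robustBarlowTemplate_shared :
    Summit.AtomisticToContinuum.Crystallization.Theses.HullExactificationCascade.RobustBarlowTemplate ↔
      Summit.AtomisticToContinuum.Crystallization.Theses.DisclinationRation.RobustBarlowTemplate :=
  Iff.rfl

/-! ## (a) Load-bearing hypotheses -/

/-- The template is never empty. -/
theorem idealStacking_nonempty (s : ℤ → ℤ) : (idealStacking s).Nonempty :=
  ⟨_, barlowPos_mem (a := 1) (h := Real.sqrt (2 / 3)) (s := s) 0 0 0⟩

/-- Two distinct template points: `barlowPos … 0 0 0 ≠ barlowPos … 0 1 0` (in-layer distance `≥ 1`). -/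
theorem barlowPos_zero_ne_one (s : ℤ → ℤ) :
    barlowPos 1 (Real.sqrt (2 / 3)) s 0 0 0 ≠ barlowPos 1 (Real.sqrt (2 / 3)) s 0 1 0 := by
  intro h
  have h1 : (1 : ℝ) ≤ dist (barlowPos 1 (Real.sqrt (2 / 3)) s 0 0 0)
      (barlowPos 1 (Real.sqrt (2 / 3)) s 0 1 0) :=
    le_dist_barlowPos_of_ne 1 (Real.sqrt (2 / 3)) s zero_le_one (by simp)
  rw [h, dist_self] at h1
  exact absurd h1 (by norm_num)

/-- `∅` is not templated (the template is nonempty). -/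
theorem not_templated_empty : ¬ Templated (∅ : Set E3) := by
  rintro ⟨s, -, Φ, hbij, -⟩
  obtain ⟨p, hp⟩ := idealStacking_nonempty s
  exact hbij.mapsTo hp

/-- A singleton is not templated (two distinct template points would be identified). -/
theorem not_templated_singleton (x : E3) : ¬ Templated ({x} : Set E3) := by
  rintro ⟨s, -, Φ, hbij, -⟩
  have h0 : Φ (barlowPos 1 (Real.sqrt (2 / 3)) s 0 0 0) = x := hbij.mapsTo (barlowPos_mem 0 0 0)
  have h1 : Φ (barlowPos 1 (Real.sqrt (2 / 3)) s 0 1 0) = x := hbij.mapsTo (barlowPos_mem 0 1 0)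
  exact barlowPos_zero_ne_one s
    (hbij.injOn (barlowPos_mem 0 0 0) (barlowPos_mem 0 1 0) (h0.trans h1.symm))

/-- THE CRUX WITHOUT `S.Nonempty`. -/
def RobustBarlowTemplateWithoutNonempty : Prop :=
  ∀ δ : ℝ, 0 < δ → ∀ S : Set E3, Sep δ S → (∀ y ∈ S, Good S y) → Templated S

/-- **`S.Nonempty` is load-bearing** (witness `S = ∅`, `δ = 1`): any proof must use it — if only to
exclude the empty configuration, for which separation and goodness hold vacuously. -/
theorem robustBarlowTemplate_false_without_nonempty : ¬ RobustBarlowTemplateWithoutNonempty :=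
  fun h => not_templated_empty (h 1 one_pos ∅ (by simp [Sep]) (by simp))

/-- THE CRUX WITHOUT pointwise goodness. -/
def RobustBarlowTemplateWithoutGood : Prop :=
  ∀ δ : ℝ, 0 < δ → ∀ S : Set E3, S.Nonempty → Sep δ S → Templated S

/-- **Goodness is load-bearing** (witness `S = {0}`, `δ = 1`; any finite `S` works, and so does every
non-close-packed lattice — see § NearMisses for the sharper count-only version). -/
theorem robustBarlowTemplate_false_without_good : ¬ RobustBarlowTemplateWithoutGood :=
  fun h => not_templated_singleton 0
    (h 1 one_pos {0} (Set.singleton_nonempty 0) (by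
      intro y hy z hz hyz
      rw [Set.mem_singleton_iff] at hy hz
      exact absurd (hy.trans hz.symm) hyz))

/-- THE CRUX WITHOUT `δ`-SEPARATION (statement only; no counterexample is known or expected).
Goodness does NOT imply uniform separation (`S = f(FCC)`, `f(x) = |x|^{-1/100} x`: all shells `1/20`-good,
`nnd → 0` at infinity — and the conclusion still holds for it, `Φ = f`), so this is a genuine
strengthening.  Dimension matters: the PLANAR analogue is FALSE — `z ↦ exp(2πi z/k)` (`k` large) wraps the
triangular lattice `ℤ[ω] ⊂ ℂ` onto a ring/log-spiral set in `ℂ ∖ {0}` (the lattice of the cylinder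
`ℂ/kℤ`), infinitely-many-to-one, with consistent `O(1/k)`-good hexagonal shells, accumulating at `0` —
while in `ℝ³` Zorich's theorem (1967: a locally homeomorphic quasiregular map
`ℝⁿ → ℝⁿ`, `n ≥ 3`, is a homeomorphism onto `ℝⁿ`) applied to the PL extension of the developed map says
the wrap cannot exist; so the separation-free version is very probably TRUE in `ℝ³`, and `δ` is needed by
the intended proof only as the cheap substitute (co-Lipschitz path lifting) for Zorich.  Recorded so that
ideators can IMPORT the exact proposition if they want to propose the separation-free strengthening. -/
def RobustBarlowTemplateWithoutSep : Prop :=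
  ∀ S : Set E3, S.Nonempty → (∀ y ∈ S, Good S y) → Templated S

/-- Sanity: the separation-free version implies the crux (so refuting the crux refutes it too). -/
theorem robustBarlowTemplate_of_withoutSep (h : RobustBarlowTemplateWithoutSep) :
    Summit.AtomisticToContinuum.Crystallization.Theses.HullExactificationCascade.RobustBarlowTemplate :=
  fun _ _ S hne _ hgood => h S hne hgood

/-! ## (a′) Calibration — the hypothesis class, kernel-checked

Every ideal Barlow stacking `barlowStacking c (c√(2/3)) s` (ANY Hägg word `s`, ANY scale `c > 0`) satisfies
the hypothesis of the crux at every point with tolerance `0` (and, consistently, its conclusion, by the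
homothety).  Consequences: the hypothesis is typed as intended (`sInf` scale `= c`, first shell = the twelve
touching points, `↥T ≃ ↥pattern` inhabited), the vacuity exit is closed formally, and the `∃ s` of the
conclusion genuinely ranges over all `±1` words (no proof may assume periodicity or a bounded scale).
Inputs: the sibling disprover's landed `ShellsToBarlowChart/Negative/Calibration.lean` (scaling, the
`c/2`-rescaled kissing shell) and `LayerShellPatterns.hasFccOrHcpShells_barlowStacking'` (Hales §1.3). -/

section Calibration

variable {s : ℤ → ℤ}

/-- `13/10 < √2`. -/
theorem thirteen_tenths_lt_sqrt_two : (13 / 10 : ℝ) < Real.sqrt 2 := by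
  rw [show (13 / 10 : ℝ) = Real.sqrt ((13 / 10) ^ 2) by rw [Real.sqrt_sq]; norm_num]
  exact Real.sqrt_lt_sqrt (by norm_num) (by norm_num)

/-- The nearest-neighbour distance of every point of the ideal stacking at scale `c` is `c`. -/
theorem nnd_idealStacking (hs : IsHaggSeq s) {c : ℝ} (hc : 0 < c) {x : E3}
    (hx : x ∈ barlowStacking c (c * Real.sqrt (2 / 3)) s) :
    nnd (barlowStacking c (c * Real.sqrt (2 / 3)) s) x = c := by
  apply IsLeast.csInf_eq
  constructor
  · -- some point at distance exactly `c`
    have h12 := ncard_touching_eq_twelve hs hc (ideal_sq c) hx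
    obtain ⟨w, hw, hwd⟩ : {w | w ∈ barlowStacking c (c * Real.sqrt (2 / 3)) s ∧ dist x w = c}.Nonempty :=
      Set.nonempty_of_ncard_ne_zero (by rw [h12]; norm_num)
    refine ⟨w, ⟨hw, ?_⟩, by show dist w x = c; rw [dist_comm]; exact hwd⟩
    rintro (rfl : w = x)
    rw [dist_self] at hwd
    exact hc.ne' hwd.symm
  · rintro r ⟨z, ⟨hz, hzx⟩, rfl⟩
    exact le_dist_of_mem_barlowStacking_ideal hs hc (ideal_sq c) hz hx hzx

/-- The first shell of a point of the ideal stacking (radius `13/10 · c`) is its `5c/4`-shell: both are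
the twelve touching points (distance gap `(c, √2 c)`). -/
theorem shell_idealStacking_eq (hs : IsHaggSeq s) {c : ℝ} (hc : 0 < c) {x : E3}
    (hx : x ∈ barlowStacking c (c * Real.sqrt (2 / 3)) s) :
    shell (barlowStacking c (c * Real.sqrt (2 / 3)) s) x =
      {y : E3 | y ∈ barlowStacking c (c * Real.sqrt (2 / 3)) s ∧ y ≠ x ∧ dist y x ≤ 5 / 4 * c} := by
  ext y
  simp only [shell, Set.mem_setOf_eq, nnd_idealStacking hs hc hx]
  constructor
  · rintro ⟨hy, hne, hlt⟩
    have h13 : 13 / 10 * c < Real.sqrt 2 * c := mul_lt_mul_of_pos_right thirteen_tenths_lt_sqrt_two hc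
    have h := dist_eq_of_dist_le_of_lt hs hc (ideal_sq c) hy hx hne h13 hlt.le
    exact ⟨hy, hne, by rw [h]; linarith⟩
  · rintro ⟨hy, hne, hle⟩
    have h54 : 5 / 4 * c < Real.sqrt 2 * c :=
      mul_lt_mul_of_pos_right (lt_trans (by norm_num) thirteen_tenths_lt_sqrt_two) hc
    have h := dist_eq_of_dist_le_of_lt hs hc (ideal_sq c) hy hx hne h54 hle
    exact ⟨hy, hne, by rw [h]; linarith⟩

/-- From an exact arrangement of the shell to the crux's matching (distance `0 ≤ 1/20`). -/
theorem matched_of_shell_eq_image {S : Set E3} {x : E3} {c : ℝ} (hc : 0 < c)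
    (hnnd : nnd S x = c) {P : Finset E3} (A : E3 →ₗᵢ[ℝ] E3)
    (hT : shell S x = (fun p : E3 => x + c • A p) '' (P : Set E3)) :
    ∃ e : ↥(shell S x) ≃ ↥P, ∀ t : ↥(shell S x),
      dist ((nnd S x)⁻¹ • ((t : E3) - x)) (A ((e t : ↥P) : E3)) ≤ 1 / 20 := by
  classical
  let g : ↥P → ↥(shell S x) := fun p =>
    ⟨x + c • A (p : E3), by rw [hT]; exact Set.mem_image_of_mem _ (Finset.mem_coe.2 p.2)⟩
  have hg : Function.Bijective g := by
    constructor
    · intro p q hpq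
      have h1 : x + c • A (p : E3) = x + c • A (q : E3) := congrArg Subtype.val hpq
      have h2 : A (p : E3) = A (q : E3) := smul_right_injective E3 hc.ne' (add_left_cancel h1)
      exact Subtype.ext (A.injective h2)
    · rintro ⟨t, ht⟩
      rw [hT] at ht
      obtain ⟨p, hp, rfl⟩ := ht
      exact ⟨⟨p, Finset.mem_coe.1 hp⟩, rfl⟩
  refine ⟨(Equiv.ofBijective g hg).symm, fun t => ?_⟩
  have ht : g ((Equiv.ofBijective g hg).symm t) = t := (Equiv.ofBijective g hg).apply_symm_apply t
  have hval : (t : E3) = x + c • A (((Equiv.ofBijective g hg).symm t : ↥P) : E3) :=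
    (congrArg Subtype.val ht).symm
  rw [hval, hnnd, add_sub_cancel_left, smul_smul, inv_mul_cancel₀ hc.ne', one_smul, dist_self]
  norm_num

/-- **Calibration: every point of every ideal Barlow stacking (any Hägg word `s`, any scale `c > 0`) is
`1/20`-good in the crux's sense** — indeed `0`-good: nearest-neighbour distance `c`, first shell = the
twelve touching points, EXACTLY the rotated FCC pattern (layers `k` with `s (k-1) = s k`) or HCP
pattern (`s (k-1) ≠ s k`).  So the hypothesis class of `RobustBarlowTemplate` is far from vacuous and
its typing (`↥T ≃ ↥pattern`, `sInf` scale) is inhabited as intended. -/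
theorem good_idealStacking (hs : IsHaggSeq s) {c : ℝ} (hc : 0 < c) {x : E3}
    (hx : x ∈ barlowStacking c (c * Real.sqrt (2 / 3)) s) :
    Good (barlowStacking c (c * Real.sqrt (2 / 3)) s) x := by
  obtain ⟨k, i, j, rfl⟩ := hx
  set x := barlowPos c (c * Real.sqrt (2 / 3)) s k i j with hxdef
  have hx : x ∈ barlowStacking c (c * Real.sqrt (2 / 3)) s := barlowPos_mem k i j
  have hnnd := nnd_idealStacking hs hc hx
  -- the shell, recentred, is the `c/2`-scaled kissing shell of Hales's stacking
  have hrec : (fun y : E3 => y - x) '' shell (barlowStacking c (c * Real.sqrt (2 / 3)) s) x =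
      (fun z : E3 => (c / 2) • z) ''
        kissingShell (barlowStacking 2 (2 * Real.sqrt (2 / 3)) s)
          (barlowPos 2 (2 * Real.sqrt (2 / 3)) s k i j) := by
    rw [shell_idealStacking_eq hs hc hx, hxdef]
    exact shellSet_eq_image_kissingShell hs hc k i j
  -- undo the recentring
  have hshell : ∀ (P : Finset E3) (A : E3 →ₗᵢ[ℝ] E3),
      kissingShell (barlowStacking 2 (2 * Real.sqrt (2 / 3)) s)
          (barlowPos 2 (2 * Real.sqrt (2 / 3)) s k i j) = (fun p => (2 : ℝ) • A p) '' (P : Set E3) →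
      shell (barlowStacking c (c * Real.sqrt (2 / 3)) s) x = (fun p : E3 => x + c • A p) '' (P : Set E3) := by
    intro P A hA
    have himg : shell (barlowStacking c (c * Real.sqrt (2 / 3)) s) x =
        (fun z : E3 => x + z) '' ((fun y : E3 => y - x) '' shell (barlowStacking c (c * Real.sqrt (2 / 3)) s) x) := by
      rw [Set.image_image]; simp
    rw [himg, hrec, hA, Set.image_image, Set.image_image]
    refine Set.image_congr' fun p => ?_
    rw [smul_smul, show c / 2 * 2 = c by ring]
  rcases hasFccOrHcpShells_barlowStacking' hs _ (barlowPos_mem k i j) with ⟨A, hA⟩ | ⟨A, hA⟩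
  · exact ⟨A, Or.inl (matched_of_shell_eq_image hc hnnd A (hshell _ A hA))⟩
  · exact ⟨A, Or.inr (matched_of_shell_eq_image hc hnnd A (hshell _ A hA))⟩

/-- The ideal stacking at scale `c` is the `c`-multiple of the unit ideal stacking. -/
theorem smul_image_idealStacking {c : ℝ} (hc : c ≠ 0) :
    (fun p : E3 => c • p) '' idealStacking s = barlowStacking c (c * Real.sqrt (2 / 3)) s := by
  ext y
  simp only [Set.mem_image, idealStacking]
  constructor
  · rintro ⟨p, hp, rfl⟩
    have := (smul_mem_barlowStacking_iff (t := c) (a := 1) (h := Real.sqrt (2 / 3)) hc (s := s) (x := p)).2 hp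
    simpa using this
  · intro hy
    refine ⟨c⁻¹ • y, ?_, by rw [smul_smul, mul_inv_cancel₀ hc, one_smul]⟩
    have h := (smul_mem_barlowStacking_iff (t := c) (a := 1) (h := Real.sqrt (2 / 3)) hc (s := s)
      (x := c⁻¹ • y))
    rw [smul_smul, mul_inv_cancel₀ hc, one_smul, mul_one] at h
    exact h.1 hy

/-- **Calibration of the conclusion**: the ideal stacking at scale `c > 0` is templated (by the homothety
`p ↦ c • p`, tolerance `0`). -/
theorem templated_idealStacking (hs : IsHaggSeq s) {c : ℝ} (hc : 0 < c) :
    Templated (barlowStacking c (c * Real.sqrt (2 / 3)) s) := by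
  refine ⟨s, hs, fun p => c • p, ?_, ?_⟩
  · rw [← smul_image_idealStacking hc.ne']
    exact ⟨Set.mapsTo_image _ _, (smul_right_injective E3 hc.ne').injOn, Set.surjOn_image _ _⟩
  · intro p _
    refine ⟨LinearIsometry.id, c, hc, fun q _ _ => ?_⟩
    rw [LinearIsometry.id_apply, ← smul_add, add_sub_cancel, dist_self]
    positivity

/-- **Non-vacuity of the crux, kernel-checked**: for every Hägg word `s` and every scale `c > 0` the ideal
stacking is nonempty, `c`-separated and everywhere good — and (consistently with the crux) templated. -/
theorem hypothesis_idealStacking (hs : IsHaggSeq s) {c : ℝ} (hc : 0 < c) :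
    (barlowStacking c (c * Real.sqrt (2 / 3)) s).Nonempty ∧
      Sep c (barlowStacking c (c * Real.sqrt (2 / 3)) s) ∧
      (∀ y ∈ barlowStacking c (c * Real.sqrt (2 / 3)) s, Good (barlowStacking c (c * Real.sqrt (2 / 3)) s) y) ∧
      Templated (barlowStacking c (c * Real.sqrt (2 / 3)) s) :=
  ⟨⟨_, barlowPos_mem 0 0 0⟩,
    fun _ hy _ hz hyz => le_dist_of_mem_barlowStacking_ideal hs hc (ideal_sq c) hy hz hyz,
    fun _ hy => good_idealStacking hs hc hy, templated_idealStacking hs hc⟩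

end Calibration

/-! ## (b) Natural strengthenings — statements (refuted on paper / numerically, see module docstring) -/

/-- UNIFORM similarity: one `l`, one `A` for all `p`.  FALSE by radial scale drift `x ↦ |x|^{1/100} x`
applied to FCC (all shells `1/20`-good, `d` unbounded).  Not formalised. -/
def TemplatedUniform (S : Set E3) : Prop :=
  ∃ s : ℤ → ℤ, IsHaggSeq s ∧ ∃ Φ : E3 → E3, Set.BijOn Φ (idealStacking s) S ∧
    ∃ A : E3 →ₗᵢ[ℝ] E3, ∃ l : ℝ, 0 < l ∧ ∀ p ∈ idealStacking s,
      ∀ q ∈ idealStacking s, dist q p ≤ 1 → dist (Φ q) (Φ p + l • A (q - p)) ≤ 1 / 20 * l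

/-- The uniform template trivially implies the crux's template. -/
theorem templated_of_uniform {S : Set E3} (h : TemplatedUniform S) : Templated S := by
  obtain ⟨s, hs, Φ, hbij, A, l, hl, hloc⟩ := h
  exact ⟨s, hs, Φ, hbij, fun p hp => ⟨A, l, hl, hloc p hp⟩⟩

/-! ## (c) Line `registered` (`Lines/birth.lean`, lead c3) — stub audit, cycle 1

* `stub_reciprocity` (M): TRUE.  "Why it resists" 2 gives the sharper ratio `[1/1.05, 1.05]`; the only
  pattern facts used are `‖p‖ = 1`, pairwise `≥ 1` (in tree) and the `45°` covering radius (NOT in tree: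
  `∀ u ≠ 0, ∃ p ∈ P, ⟪u, A p⟫ ≥ ‖u‖/√2` for both patterns; the stub only needs `> 0.474 ‖u‖`, and the
  `60°` bound `≥ ‖u‖/2` already holds because every open hemisphere-cap of angular radius `60°` about any
  direction contains a pattern point — both certified numerically in `numerics/patterns.py`, exact value
  `cos 45° = 1/√2` at the six square-face centres).  Hypotheses: `Sep δ S` is NOT used by the argument
  (only `d(y) > 0`, which needs two points — automatic when `T(y) ≠ ∅`); `0 < δ` idem.  So the stub is
  true even as `∀ S, (∀ y ∈ S, Good S y) → Recip S`.
* `stub_exhaust` (M): TRUE by the card's descent, checked: for foreign `y` with nearest template point `m`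
  at distance `r`, `r ≥ 1.3 d(m)`, `r ≥ 1.3 d(y)`, and the shell point `w` of `y` towards `m` has
  `dist(w, M)² ≤ r² − 0.74 d(y)² ≤ r² − 0.74 δ²` (numerically `√(1 − √2 x + x²) + x/20 ≤ 1 − 0.18 x` on
  `(0, 0.77]`), so `inf dist(·, M)` over foreign points is not approached — contradiction.  Here `Sep δ`
  IS load-bearing (the descent needs a uniform decrement; without it an everywhere-good `S` with a second
  ~-component of geometrically shrinking scale is not excluded by the local argument alone) and so is
  `Recip`.  Corollary worth stating for the lead: the shell graph `(S, ~)` is CONNECTED.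
* `stub_develop` (L, load-bearing): TRUE via "Why it resists" 3–4; the honest content is GLOBAL
  INJECTIVITY = the covering argument with floor `δ`; everything local is exact combinatorics with margins
  `1.1025 < 1.3142`, `0.848 < 0.9`, `1.514 < 1.554`.  `ShellClosed` and `LocSim` hold for the true `Φ`
  by construction.  No hypothesis of the stub is droppable except that `Recip` is implied by the others.
  WARNINGS for the injectivity step (each is a FALSE shortcut, by the drift examples of Index (b)):
  "`nnd S` is bounded above on `S`" (false: `|x|^α x`), "the image of a template layer lies in a plane /
  within bounded distance of a plane" (false: both drifts bend layers by unbounded amounts), "far-apart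
  charts have comparable frames `A`" (false: log-spiral), "9227's growth descent applies" (needs scale
  `≤ 1`; here only `δ ≤ nnd`).  What IS true and sufficient: the developed map is a local homeomorphism on
  the cell complex and uniformly co-Lipschitz at scale `δ` (every template edge maps to a segment of length
  `≥ 0.95 δ/1.05`, adjacent cells do not fold), hence a covering map of `ℝ³`, hence injective.  Division
  of labour that the numbers support: developing along the simply connected TEMPLATE gives `MapsTo`,
  `LocSim` and `ShellClosed` for free (the only holonomy to check is around template triangles and squares,
  i.e. chart consistency on exact links — `develop_charts`); `InjOn` is then EQUIVALENT to "the PL extension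
  is a covering of `ℝ³`", and the `δ`-floor is exactly what makes path lifting work (steps `≥ 0.9 δ`).
  Nothing weaker can do in the plane: the development of the triangular lattice onto its image under
  `z ↦ exp(2πi z/k)` is a covering of `ℂ ∖ {0}` — consistent charts, exact links, NOT injective — and
  what fails there is precisely uniform separation (scale `→ 0` at the centre); in `ℝ³` Zorich's theorem
  suggests even that is not needed (see `RobustBarlowTemplateWithoutSep`).
* Joint sufficiency: the lead's `composition` is kernel-checked; the split is lossless (each stub is
  implied by the crux's conclusion plus reciprocity, which is itself a consequence of goodness).
-/

/-! ## NearMisses (paper proofs; `sorry` permitted only here) -/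

section NearMisses

/-- COUNT-ONLY goodness: `T(y)` has exactly twelve points (no metric pattern match). -/
def CountGood (S : Set E3) (y : E3) : Prop := (shell S y).ncard = 12 ∧ (shell S y).Finite

/-- The crux with goodness weakened to count-only goodness. -/
def RobustBarlowTemplateCountOnly : Prop :=
  ∀ δ : ℝ, 0 < δ → ∀ S : Set E3, S.Nonempty → Sep δ S → (∀ y ∈ S, CountGood S y) → Templated S

/-- **Near-miss (paper proof, not closed in Lean): count-only goodness does NOT give the template.**
Witness `S = barlowStacking 1 (23/20) alternatingHagg` (hcp stretched along the axis by 41 %):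
`d = 1`, distance spectrum from any site `1.0 (×6), 1.2868 (×6), 1.6297 (×6), √3 (×6), 1.912 (×12), 2 (×6)`,
so `T(y)` = twelve points (`1.3 · d = 1.3 > 1.2868`), `S` is `1`-separated and homogeneous.  If `Φ`
templated `S`, the PL extension of `Φ` to the tetrahedron–octahedron cells of the ideal stacking would be
a local homeomorphism (adjacent clusters are `1/20`-similar with consistent orientation), complete
(`l_p ≥ δ/1.05`), hence a homeomorphism of `ℝ³`; the open star of `p` then maps onto a neighbourhood of
`Φ p` containing `B(Φ p, 0.7 l_p)` free of other points of `S`, so `l_p ≤ 1/0.7 = 1.43`; but the twelve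
cluster images lie in the annulus `[0.95 l_p, 1.05 l_p]`, which holds `≤ 6` points of `S` unless
`l_p ≥ 1.65`.  Obstruction to closing it here: the homeomorphism/degree step (invariance of domain for the
PL extension) — the same covering machinery `stub_develop` needs; what was tried: annulus counting alone
(fails: `l_p` is not bounded above by local metric data, the annulus `[1.63, 1.73]` holds 12 points). -/
theorem robustBarlowTemplate_false_countOnly : ¬ RobustBarlowTemplateCountOnly := by
  sorry

end NearMisses

end Summit.AtomisticToContinuum.Crystallization.Cruxes.RobustBarlowTemplate.Disproof

end
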